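import Mathlib.Analysis.SpecialFunctions.Pow.Real
import HarnessLib

/-!
# Scalar bookkeeping for the equilibrium concentration of the Lambertian window collision count
# (`LambertianContactSwap.LambertianEuler`, stmt-AtomisticToContinuum-11854, line `Sketch`; lead c10,
# final assembly, part 2: registered stub `cells_bookkeeping`)

Support file (`--supports stmt-AtomisticToContinuum-11854`).  Pure real-arithmetic steps of lead c10's
theorem `windowCountOverflow_equilibrium_le`, isolated so that the measure-theoretic assembly stays
short.  Notation of the theorem: `n1 = N + 1`, `ε = hsDiameter σ N` with `n1 ε³ = σ³` and
`P := n1² ε² = σ² n1^{4/3}`, cell width `δ = κ ε`, number of cells `J` with `J δ ≤ 2h`, cell mean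
`μc = P δ`, tail tolerance `η' = η/(6σ²)`, mark constant `Cm`, and the cell parameter
`κ ≤ min(1, η/(18 Cm σ⁵), 2η/(9 Cm σ²))`.

* `le_of_pow_three_le` — a one-liner;
* `ceil_cells` — `J := ⌈h/δ⌉₊` satisfies `h ≤ J δ ≤ 2h` when `0 < δ ≤ h`;
* `cells_bookkeeping` — `J η' μc + 3 n1² Cm (n1 ε⁴ δ + ε² δ²/(1/2)²) (J δ) ≤ η h n1^{4/3}`:
  the cell terms give `≤ η' P · 2h = (η/3) h n1^{4/3}`, the marked terms
  `6 Cm h P (κ σ³ + κ²/4) ≤ (2η/3) h n1^{4/3}` by the choice of `κ` (`n1³ε⁴δ = κσ³P`, `4Pδ² ≤ Pκ²/4` as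
  `ε ≤ 1/4`).

All statements [folklore].
-/

noncomputable section

namespace Summit.AtomisticToContinuum.HydrodynamicLimit.Theorems.LambertianContactSwapLambertianEulerWindowCountArith

/-- From `a³ ≤ b³` with `a, b ≥ 0` conclude `a ≤ b`. [folklore] -/
theorem le_of_pow_three_le {a b : ℝ} (ha : 0 ≤ a) (hb : 0 ≤ b) (h : a ^ 3 ≤ b ^ 3) : a ≤ b :=
  (pow_le_pow_iff_left₀ ha hb three_ne_zero).1 h

/-- **The number of cells.**  For `0 < δ ≤ h` the integer `J := ⌈h/δ⌉₊` satisfies `h ≤ J δ ≤ 2h`.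
[folklore] -/
theorem ceil_cells {h δ : ℝ} (hδ : 0 < δ) (hδh : δ ≤ h) :
    h ≤ (⌈h / δ⌉₊ : ℝ) * δ ∧ (⌈h / δ⌉₊ : ℝ) * δ ≤ 2 * h := by
  constructor
  · have := Nat.le_ceil (h / δ)
    rwa [div_le_iff₀ hδ] at this
  · have hh : 0 ≤ h := hδ.le.trans hδh
    have h1 : ((⌈h / δ⌉₊ : ℕ) : ℝ) < h / δ + 1 := Nat.ceil_lt_add_one (div_nonneg hh hδ.le)
    have h2 : (⌈h / δ⌉₊ : ℝ) * δ < h + δ := by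
      have := mul_lt_mul_of_pos_right h1 hδ
      rwa [add_mul, one_mul, div_mul_cancel₀ _ hδ.ne'] at this
    linarith only [h2, hδh]

/-- **The scalar bookkeeping of the concentration theorem** (registered stub `cells_bookkeeping` of lead
c10).  With `P = n1² ε² = σ² n1^{4/3}`, `n1 ε³ = σ³`, `δ = κ ε`, `0 < ε ≤ 1/4`, `Jr δ ≤ 2h`,
`η' = η/(6σ²)` and `0 < κ ≤ 1`, `κ ≤ η/(18 Cm σ⁵)`, `κ ≤ 2η/(9 Cm σ²)`:
`Jr (η' (P δ)) + 3 (n1² (Cm (n1 ε⁴ δ + ε² δ²/(2⁻¹)²)) (Jr δ)) ≤ η h n1^{4/3}`. [folklore] -/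
theorem cells_bookkeeping :
    ∀ (σ η Cm κ ε δ h Jr n1 n43 P : ℝ), 0 < σ → 0 < η → 0 < Cm → 0 < κ → κ ≤ 1 →
      κ ≤ η / (18 * Cm * σ ^ 5) → κ ≤ 2 * η / (9 * Cm * σ ^ 2) →
      0 < ε → ε ≤ 1 / 4 → δ = κ * ε → 0 < h → 0 ≤ Jr → Jr * δ ≤ 2 * h → 0 < n1 → 0 ≤ n43 →
      n1 * ε ^ 3 = σ ^ 3 → P = n1 ^ 2 * ε ^ 2 → P = σ ^ 2 * n43 →
      Jr * (η / (6 * σ ^ 2) * (P * δ)) +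
          3 * (n1 ^ 2 * (Cm * (n1 * ε ^ 4 * δ + ε ^ 2 * δ ^ 2 / (2⁻¹) ^ 2)) * (Jr * δ)) ≤
        η * h * n43 := by
  intro σ η Cm κ ε δ h Jr n1 n43 P hσ hη hCm hκpos hκle1 hκ1 hκ2 hεpos hε4 hδ hhpos hJr0 hJ2 hn1 h43 hε3 hP hPe
  have hP0 : 0 ≤ P := by rw [hP]; positivity
  have hδpos : 0 < δ := by rw [hδ]; exact mul_pos hκpos hεpos
  -- the cell terms
  have hT1 : Jr * (η / (6 * σ ^ 2) * (P * δ)) ≤ (η / 3) * h * n43 := by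
    have e : Jr * (η / (6 * σ ^ 2) * (P * δ)) = η / (6 * σ ^ 2) * P * (Jr * δ) := by ring
    rw [e]
    calc η / (6 * σ ^ 2) * P * (Jr * δ) ≤ η / (6 * σ ^ 2) * P * (2 * h) :=
          mul_le_mul_of_nonneg_left hJ2 (by positivity)
      _ = (η / 3) * h * n43 := by rw [hPe]; field_simp; ring
  -- the marked terms
  have hAe : n1 ^ 3 * ε ^ 4 * δ = κ * σ ^ 3 * P := by
    calc n1 ^ 3 * ε ^ 4 * δ = κ * (n1 * ε ^ 3) * (n1 ^ 2 * ε ^ 2) := by rw [hδ]; ring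
      _ = κ * σ ^ 3 * P := by rw [hε3, hP]
  have hBe : n1 ^ 2 * (ε ^ 2 * δ ^ 2 / (2⁻¹) ^ 2) ≤ P * κ ^ 2 / 4 := by
    have hε2 : ε ^ 2 ≤ (1 / 4) ^ 2 := pow_le_pow_left₀ hεpos.le hε4 2
    have e : n1 ^ 2 * (ε ^ 2 * δ ^ 2 / (2⁻¹) ^ 2) = 4 * P * κ ^ 2 * ε ^ 2 := by rw [hδ, hP]; ring
    rw [e]
    nlinarith only [hε2, mul_nonneg hP0 (sq_nonneg κ)]
  have hκa : 6 * Cm * σ ^ 5 * κ ≤ η / 3 := by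
    have h1 := (le_div_iff₀ (by positivity : (0 : ℝ) < 18 * Cm * σ ^ 5)).1 hκ1
    nlinarith only [h1, hCm, hσ]
  have hκb : 3 / 2 * Cm * σ ^ 2 * κ ^ 2 ≤ η / 3 := by
    have h1 := (le_div_iff₀ (by positivity : (0 : ℝ) < 9 * Cm * σ ^ 2)).1 hκ2
    have h2 : κ * (κ * (9 * Cm * σ ^ 2)) ≤ κ * (2 * η) := mul_le_mul_of_nonneg_left h1 hκpos.le
    nlinarith only [h2, mul_le_mul_of_nonneg_right hκle1 (by positivity : (0 : ℝ) ≤ 2 * η), hCm, hσ, hκpos]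
  have hT2 : 3 * (n1 ^ 2 * (Cm * (n1 * ε ^ 4 * δ + ε ^ 2 * δ ^ 2 / (2⁻¹) ^ 2)) * (Jr * δ)) ≤
      (2 * η / 3) * h * n43 := by
    have e1 : n1 ^ 2 * (Cm * (n1 * ε ^ 4 * δ + ε ^ 2 * δ ^ 2 / (2⁻¹) ^ 2)) =
        Cm * (n1 ^ 3 * ε ^ 4 * δ + n1 ^ 2 * (ε ^ 2 * δ ^ 2 / (2⁻¹) ^ 2)) := by ring
    have h1 : n1 ^ 2 * (Cm * (n1 * ε ^ 4 * δ + ε ^ 2 * δ ^ 2 / (2⁻¹) ^ 2)) ≤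
        Cm * (κ * σ ^ 3 * P + P * κ ^ 2 / 4) := by
      rw [e1, hAe]
      exact mul_le_mul_of_nonneg_left (by linarith only [hBe]) hCm.le
    have hJδ0 : 0 ≤ Jr * δ := mul_nonneg hJr0 hδpos.le
    have h2 : 3 * (n1 ^ 2 * (Cm * (n1 * ε ^ 4 * δ + ε ^ 2 * δ ^ 2 / (2⁻¹) ^ 2)) * (Jr * δ)) ≤
        3 * (Cm * (κ * σ ^ 3 * P + P * κ ^ 2 / 4)) * (2 * h) := by
      have := mul_le_mul h1 hJ2 hJδ0 (by positivity)
      nlinarith only [this]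
    have e2 : 3 * (Cm * (κ * σ ^ 3 * P + P * κ ^ 2 / 4)) * (2 * h) =
        (6 * Cm * σ ^ 5 * κ + 3 / 2 * Cm * σ ^ 2 * κ ^ 2) * h * n43 := by rw [hPe]; ring
    rw [e2] at h2
    have h3 : (6 * Cm * σ ^ 5 * κ + 3 / 2 * Cm * σ ^ 2 * κ ^ 2) * h * n43 ≤ (2 * η / 3) * h * n43 := by
      have := mul_nonneg hhpos.le h43
      nlinarith only [hκa, hκb, this]
    exact h2.trans h3
  nlinarith only [hT1, hT2, mul_nonneg hhpos.le h43]

end Summit.AtomisticToContinuum.HydrodynamicLimit.Theorems.LambertianContactSwapLambertianEulerWindowCountArith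

end
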